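import Summits.BirchSwinnertonDyer.BirchSwinnertonDyer.Theorems.ManinLocalTwoThreeKummerSquareCharacterEndgame
import Summits.BirchSwinnertonDyer.BirchSwinnertonDyer.Theorems.ManinLocalTwoThreeKummerCoverSubgroup
import Summits.BirchSwinnertonDyer.Rank1Residual.ManinAdditive.UDCKummerLineHolds
import HarnessLib

/-!
# The ℓ = 2 UDC chain, nodes (NC₂-a) and (NC₂-glue): the KUMMER COVER GROUP OF A RATIONAL `2`-TORSION POINT is a finite-index normal subgroup
# of `Γ₀(N)` containing the parabolics; hence CONGRUENCE of the ℓ = 2 Kummer character forces `Γ₁(N)`-periodicity of the `σ`-square root, and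
# (LEAD's endgame) `Λ₁(f) ≠ Λ₀(f)` — so on the ROOT-NUMBER `−1` half a congruence conclusion is CONTRADICTORY (mod F★, F♮, CES)
(route `ManinLocalTwoThree`, deciding crux C2 `ManinOddAtFour` stmt-BirchSwinnertonDyer-22967; cell bsd-f2-manin, prover p2 gen 19; LEAD-MEMO v35 §3–§4
«p2/p3: the ℓ = 2 UDC chain — port `KummerCover*` to square roots»; `--supports stmt-BirchSwinnertonDyer-22967`)

SETTING (p2 g16/g17 `…SigmaSquareRootLeaves`, `…KummerSquareRootSigmaDictionary`; LEAD g18 `…KummerSquareCharacterEndgame`).  `D` an `X₀(N)`-datum of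
`W` with the lattice clause `Λ := Λ_W ⊆ c·Λ₀(f)`, `a` a HALF-PERIOD (`a ∉ Λ`, `2a = m₁ω₁ + m₂ω₂` — the lift of a rational `2`-torsion point `T`, S6₂),
`V = sigmaSqRoot Λ a e`, `e = m₁η₁ + m₂η₂`, the `σ`-square root of `x − x(T)` (S3₂).  The ℓ = 2 port of the ℓ = 3 nodes (NC-a) `kummerCoverSubgroup_holds`
(LEAD p1 g15) and of the glue `Γ(MN) ≤ Γ₀(N) ∩ Γ(M)` + Kurth–Long type II (LEAD's `…UDCLineAtNine` §1–§2), DEF-FREE (the ℓ = 2 objects are not typed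
yet, T-p1-g18-1; the would-be `KummerPeriodTrivialTwo D a γ := ∃ k ν, ν ∈ Λ ∧ c·{∞,γ∞}_f = k·(2a) + 2ν` is written out):
* §1 `exists_two_classes_of_two_mul_mem` — the `𝔽₂`-structure: `Λ/(ℤ·2a + 2Λ)` has ≤ 2 classes (`x ≡ 0` or `≡ r`);
* §2 `sigmaSqRoot_add_intMul_eq`, `sigmaSqRoot_add_mem_lattice_eq` (the multiplier of `V` at `mω₁ + nω₂` in closed form) and
  **`sigmaSqRoot_periodic_of_mem_kummerTwo`**: `V` IS PERIODIC under every `ω ∈ ℤ·2a + 2Λ` (Legendre's relation; the multiplier is the Weil pairing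
  `e₂(T, ·)`, trivial on `⟨T⟩`) — the forward half of S4₂;
* §3 **(NC₂-a) `exists_kummerCoverSubgroupTwo`** — `Γ_{T,2} = {γ ∈ Γ₀(N) : c·{∞,γ∞}_f ∈ ℤ·2a + 2Λ}` is a subgroup of `SL₂(ℤ)` inside `Γ₀(N)`, of
  FINITE INDEX (two cosets over `Γ₀(N)`), NORMAL in `Γ₀(N)`, containing every element of trace `±2`; and **(NC₂-a′) `exists_sigmaSqRootPeriodSubgroup`** —
  the same for the PERIOD group `Γ_V = {γ ∈ Γ₀(N) : V(· + c{∞,γ∞}_f) = V}` ⊇ `Γ_{T,2}` (the exact stabiliser that LEAD's endgame and p2's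
  `forall_gamma_smul_eq_iff_sigmaSqRoot_periodic` speak about);
* §4 **(NC₂-glue) `sigmaSqRoot_gamma1_periodic_of_congruence`** — if `V` is periodic under `c{∞,γ∞}_f` for every `γ ∈ Γ₀(N) ∩ Γ(M)` (`M ≥ 1`; the
  output shape of Unbounded Denominators applied to a modular-form witness with stabiliser `Γ_V`), then for every `γ ∈ Γ₁(N)` (Kurth–Long Prop. 18 =
  tree theorem `typeIINoncongruence_holds`, applied to `Γ_V ⊇ Γ(MN)`); hence **`periodLatticeGamma1_ne_of_congruence`**: `Λ₁(f) ≠ Λ₀(f)` (LEAD's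
  `periodLatticeGamma1_ne_of_sigmaSqRoot_gamma1_periodic`), and, modulo the printed cusp facts F★, F♮, CES, **`rootNumber_eq_one_of_congruence_of_print`**:
  such a curve has ROOT NUMBER `+1` — on the root-number-`−1` half the congruence conclusion of an ℓ = 2 UDC chain is impossible.
LEFT of the ℓ = 2 chain: (BI₂) (next file) and the WITNESS LAW (AN2₂) — a holomorphic weight-`k` form with algebraic-integer `q`-expansion, exponential
growth at the cusps and `Γ₀(N)`-stabiliser `Γ_V` (port of the ℓ = 3 witness line); then CDT.
HONEST FRAMING.  Group/lattice bookkeeping and compositions of landed theorems; CONDITIONAL where marked (`_of_print`: F★, F♮, CES); no step of the analytic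
witness law is proved here; C2, Manin's conjecture and BSD are NOT proved.  No definitions (the subgroups are existential witnesses), no sorry.
[cite: KurthLong2008, Def. 16 and Prop. 18] [cite: WhittakerWatson1927, §20.421 (quasi-periodicity of σ), §20.411 (Legendre's relation)]
[cite: SilvermanAEC2009, III.8 (Weil pairing; shape)] [cite: Manin1972, Prop. 1.4 / Thm. 1.6] [cite: Stevens1989, §2]
-/

set_option autoImplicit false
-- lint-debt: the directory name repeats the summit name (sibling precedent `ManinLocalTwoThreeKummerCoverSubgroup.lean`)
set_option linter.dupNamespace false

noncomputable section

open scoped MatrixGroups ModularForm PeriodPair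
open CongruenceSubgroup Complex
open WeierstrassCurve Literature.NumberTheory.EllipticCurves Literature.NumberTheory.EllipticCurves.ModularForms
open Summit.BirchSwinnertonDyer.Rank1Residual.ManinAdditive
open Summit.BirchSwinnertonDyer.Rank1Residual.ManinAdditive.UDCKummerLine
open Summit.BirchSwinnertonDyer.BirchSwinnertonDyer.Theorems.ManinLocalTwoThree.SigmaSquareRoot
open Summit.BirchSwinnertonDyer.BirchSwinnertonDyer.Theorems.ManinLocalTwoThree.SigmaHabitat

namespace Summit.BirchSwinnertonDyer.BirchSwinnertonDyer.Theorems.ManinLocalTwoThree.UDCTwo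

/-! ## §1 The `𝔽₂`-structure of `Λ/(ℤ·2a + 2Λ)` -/

/-- One coordinate case: `2a = αω₁ + βω₂` with `β` odd ⟹ `r = ω₁` works: every `x ∈ Λ` is `≡ 0` or `≡ ω₁ (mod ℤ·2a + 2Λ)`. [folklore] -/
theorem exists_two_classes_of_two_mul_mem_aux (L : PeriodPair) {a : ℂ} {α β : ℤ}
    (hαβ : (α : ℂ) * L.ω₁ + (β : ℂ) * L.ω₂ = 2 * a) (hβ : ¬ (2 : ℤ) ∣ β) :
    ∀ x ∈ L.lattice, ∃ j : ℕ, j < 2 ∧ ∃ k : ℤ, ∃ ν ∈ L.lattice, x - (j : ℂ) * L.ω₁ = k * (2 * a) + 2 * ν := by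
  intro x hx
  obtain ⟨m, n, hmn⟩ := PeriodPair.mem_lattice.mp hx
  -- `k = n` (`β` odd: `n − nβ` is even) and the quotient `q₂ = (n − kβ)/2`
  obtain ⟨t, ht⟩ : ∃ t, β = 2 * t + 1 := ⟨β / 2, by omega⟩
  obtain ⟨k, q₂, hk⟩ : ∃ k q₂ : ℤ, n - k * β = 2 * q₂ := ⟨n, -(n * t), by rw [ht]; ring⟩
  -- `j = (m − kα) mod 2`, `q₁ = (m − kα − j)/2`
  obtain ⟨j, q₁, hj2, hj⟩ : ∃ (j : ℕ) (q₁ : ℤ), j < 2 ∧ m - k * α - j = 2 * q₁ := by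
    refine ⟨((m - k * α) % 2).toNat, (m - k * α) / 2, ?_, ?_⟩ <;> omega
  refine ⟨j, hj2, k, (q₁ : ℂ) * L.ω₁ + (q₂ : ℂ) * L.ω₂, ?_, ?_⟩
  · exact PeriodPair.mem_lattice.mpr ⟨q₁, q₂, rfl⟩
  · rw [← hmn, ← hαβ]
    have hj' : ((j : ℤ) : ℂ) = (j : ℂ) := by norm_cast
    have e1 : (m : ℂ) = k * α + 2 * q₁ + (j : ℤ) := by exact_mod_cast (by linarith : m = k * α + 2 * q₁ + j)
    have e2 : (n : ℂ) = k * β + 2 * q₂ := by exact_mod_cast (by linarith : n = k * β + 2 * q₂)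
    rw [e1, e2, hj']
    ring

/-- **Two classes.**  If `a ∉ Λ` and `2a ∈ Λ` then for one `r ∈ Λ` every `x ∈ Λ` satisfies `x − j·r ∈ ℤ·2a + 2Λ` for some `j ∈ {0,1}`
(`Λ/(ℤ·2a + 2Λ) ≅ ℤ/2`). [folklore] -/
theorem exists_two_classes_of_two_mul_mem (L : PeriodPair) {a : ℂ} (ha : a ∉ L.lattice) (h2a : 2 * a ∈ L.lattice) :
    ∃ r ∈ L.lattice, ∀ x ∈ L.lattice, ∃ j : ℕ, j < 2 ∧ ∃ k : ℤ, ∃ ν ∈ L.lattice, x - (j : ℂ) * r = k * (2 * a) + 2 * ν := by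
  obtain ⟨α, β, hαβ⟩ := PeriodPair.mem_lattice.mp h2a
  by_cases hβ : (2 : ℤ) ∣ β
  · -- then `α` is odd (else `a ∈ Λ`); use `r = ω₂` via the swapped pair
    have hα : ¬ (2 : ℤ) ∣ α := by
      rintro ⟨α', rfl⟩
      obtain ⟨β', rfl⟩ := hβ
      apply ha
      refine PeriodPair.mem_lattice.mpr ⟨α', β', ?_⟩
      have h2 : (2 : ℂ) ≠ 0 := by norm_num
      apply mul_left_cancel₀ h2
      rw [← hαβ]; push_cast; ring
    let L' : PeriodPair := ⟨L.ω₂, L.ω₁, by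
      have h := L.indep
      rw [LinearIndependent.pair_iff] at h ⊢
      intro s t hst
      have := h t s (by rw [add_comm]; simpa [add_comm] using hst)
      exact ⟨this.2, this.1⟩⟩
    have hL' : ∀ x, x ∈ L'.lattice ↔ x ∈ L.lattice := fun x ↦ by
      simp only [PeriodPair.mem_lattice]
      constructor
      · rintro ⟨m, n, h⟩; exact ⟨n, m, by rw [← h]; ring⟩
      · rintro ⟨m, n, h⟩; exact ⟨n, m, by rw [← h]; ring⟩
    have hαβ' : (β : ℂ) * L'.ω₁ + (α : ℂ) * L'.ω₂ = 2 * a := by rw [← hαβ]; show (β : ℂ) * L.ω₂ + α * L.ω₁ = _; ring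
    refine ⟨L.ω₂, L.ω₂_mem_lattice, fun x hx ↦ ?_⟩
    obtain ⟨j, hj, k, ν, hν, e⟩ := exists_two_classes_of_two_mul_mem_aux L' hαβ' hα x ((hL' x).mpr hx)
    exact ⟨j, hj, k, ν, (hL' ν).mp hν, e⟩
  · exact ⟨L.ω₁, L.ω₁_mem_lattice, exists_two_classes_of_two_mul_mem_aux L hαβ hβ⟩

/-! ## §2 The `σ`-square root is periodic under `ℤ·2a + 2Λ` -/

/-- Iterating a constant multiplier: `V(w + ω) = e^A·V(w)` for all `w` ⟹ `V(w + mω) = e^{mA}·V(w)` for every integer `m`.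
[cite: WhittakerWatson1927, §20.421] -/
theorem sigmaSqRoot_add_intMul_eq {L : PeriodPair} {a e ω A : ℂ}
    (hω : ∀ w : ℂ, sigmaSqRoot L a e (w + ω) = cexp A * sigmaSqRoot L a e w) (m : ℤ) (w : ℂ) :
    sigmaSqRoot L a e (w + m * ω) = cexp (m * A) * sigmaSqRoot L a e w := by
  induction m using Int.induction_on generalizing w with
  | zero => simp
  | succ n ih =>
    rw [show w + ((n : ℤ) + 1 : ℤ) * ω = (w + (n : ℤ) * ω) + ω by push_cast; ring, hω, ih, ← mul_assoc,
      ← Complex.exp_add]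
    congr 2; push_cast; ring
  | pred n ih =>
    have h := hω (w + (-(n : ℤ) - 1 : ℤ) * ω)
    rw [show w + ((-(n : ℤ) - 1 : ℤ) : ℂ) * ω + ω = w + ((-(n : ℤ) : ℤ) : ℂ) * ω by push_cast; ring, ih] at h
    have hA : cexp A ≠ 0 := Complex.exp_ne_zero A
    calc sigmaSqRoot L a e (w + ((-(n : ℤ) - 1 : ℤ) : ℂ) * ω)
        = (cexp A)⁻¹ * (cexp (((-(n : ℤ) : ℤ) : ℂ) * A) * sigmaSqRoot L a e w) := by
          rw [h, inv_mul_cancel_left₀ hA]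
      _ = cexp (((-(n : ℤ) - 1 : ℤ) : ℂ) * A) * sigmaSqRoot L a e w := by
          rw [← Complex.exp_neg, ← mul_assoc, ← Complex.exp_add]
          congr 2; push_cast; ring

/-- **The multiplier of `V_{a,e}` at a general period** `mω₁ + nω₂`:
`V(w + mω₁ + nω₂) = exp(m(eω₁ − 2aη₁)/2 + n(eω₂ − 2aη₂)/2)·V(w)`. [cite: WhittakerWatson1927, §20.421] -/
theorem sigmaSqRoot_add_mem_lattice_eq (L : PeriodPair) (a e w : ℂ) (m n : ℤ) :
    sigmaSqRoot L a e (w + ((m : ℂ) * L.ω₁ + (n : ℂ) * L.ω₂)) =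
      cexp (m * ((e * L.ω₁ - 2 * a * L.η₁) / 2) + n * ((e * L.ω₂ - 2 * a * L.η₂) / 2)) * sigmaSqRoot L a e w := by
  rw [show w + ((m : ℂ) * L.ω₁ + (n : ℂ) * L.ω₂) = (w + (m : ℂ) * L.ω₁) + (n : ℂ) * L.ω₂ by ring,
    sigmaSqRoot_add_intMul_eq (sigmaSqRoot_add_ω₂ L a e) n, sigmaSqRoot_add_intMul_eq (sigmaSqRoot_add_ω₁ L a e) m,
    ← mul_assoc, ← Complex.exp_add]
  congr 2; ring

/-- **S4₂ (forward half): `V` is periodic under `ℤ·2a + 2Λ`.**  For `2a = m₁ω₁ + m₂ω₂` and `e = m₁η₁ + m₂η₂`, every `ω = k·(2a) + 2ν`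
(`k ∈ ℤ`, `ν ∈ Λ`) is a period of `V_{a,e}`: the exponent is `(qm₁ − pm₂)(η₁ω₂ − η₂ω₁) = ±(qm₁ − pm₂)·2πi` (`ν = pω₁ + qω₂`, Legendre).
(The multiplier of `V` on `Λ` is the Weil pairing `e₂(T, ·)`, trivial exactly on `⟨T⟩ ↔ ℤ·2a + 2Λ`; only this half is needed downstream.)
[cite: WhittakerWatson1927, §20.421, §20.411] [cite: SilvermanAEC2009, III.8 (shape)] -/
theorem sigmaSqRoot_periodic_of_mem_kummerTwo (L : PeriodPair) {a : ℂ} {m₁ m₂ : ℤ}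
    (h2a : 2 * a = m₁ * L.ω₁ + m₂ * L.ω₂) {ω : ℂ} (hω : ∃ k : ℤ, ∃ ν ∈ L.lattice, ω = k * (2 * a) + 2 * ν) (w : ℂ) :
    sigmaSqRoot L a (m₁ * L.η₁ + m₂ * L.η₂) (w + ω) = sigmaSqRoot L a (m₁ * L.η₁ + m₂ * L.η₂) w := by
  obtain ⟨k, ν, hν, rfl⟩ := hω
  obtain ⟨p, q, hpq⟩ := PeriodPair.mem_lattice.mp hν
  -- Legendre: `η₁ω₂ − η₂ω₁ = s·2πi`, `s = ±1`
  obtain ⟨s, -, hδ⟩ : ∃ s : ℤ, (s = 1 ∨ s = -1) ∧ L.η₁ * L.ω₂ - L.η₂ * L.ω₁ = (s : ℂ) * (2 * Real.pi * I) := by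
    rcases L.im_ω₂_div_ω₁_pos_or with h | h
    · exact ⟨1, Or.inl rfl, by rw [L.legendre_relation_holds h]; simp⟩
    · refine ⟨-1, Or.inr rfl, ?_⟩
      have h' := L.legendre_relation_of_neg h
      linear_combination -h'
  have hω' : (k : ℂ) * (2 * a) + 2 * ν = ((k * m₁ + 2 * p : ℤ) : ℂ) * L.ω₁ + ((k * m₂ + 2 * q : ℤ) : ℂ) * L.ω₂ := by
    rw [h2a, ← hpq]; push_cast; ring
  rw [hω', sigmaSqRoot_add_mem_lattice_eq]
  have hexp : ((k * m₁ + 2 * p : ℤ) : ℂ) * ((((m₁ : ℂ) * L.η₁ + (m₂ : ℂ) * L.η₂) * L.ω₁ - 2 * a * L.η₁) / 2) +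
      ((k * m₂ + 2 * q : ℤ) : ℂ) * ((((m₁ : ℂ) * L.η₁ + (m₂ : ℂ) * L.η₂) * L.ω₂ - 2 * a * L.η₂) / 2) =
      (((q * m₁ - p * m₂) * s : ℤ) : ℂ) * (2 * Real.pi * I) := by
    push_cast
    linear_combination (-((((k : ℂ) * m₁ + 2 * p) * L.η₁ + ((k : ℂ) * m₂ + 2 * q) * L.η₂) / 2)) * h2a +
      ((q : ℂ) * m₁ - p * m₂) * hδ
  rw [hexp, Complex.exp_int_mul_two_pi_mul_I, one_mul]

/-! ## §3 (NC₂-a): the ℓ = 2 Kummer cover group and the period group of `V` -/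

variable {W : WeierstrassCurve ℚ} {N : ℕ} [NeZero N]

/-- **(NC₂-a).**  For a datum `D` with the lattice clause and a half-period `a` (`a ∉ Λ`, `2a ∈ Λ`),
`Γ_{T,2} = {γ ∈ Γ₀(N) : c·{∞,γ∞}_f ∈ ℤ·2a + 2Λ}` is a subgroup of `SL₂(ℤ)` inside `Γ₀(N)`, of finite index, normal in `Γ₀(N)`, containing every
element of trace `±2` (Manin's homomorphism `cuspSymbol_mul_holds`; two cosets by §1; zero discriminant ⟹ zero period).  The ℓ = 2 port of LEAD's
`kummerCoverSubgroup_holds`. [cite: KurthLong2008, Def. 16 (type II; shape)] [cite: Manin1972, Prop. 1.4 / Thm. 1.6] -/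
theorem exists_kummerCoverSubgroupTwo [W.IsElliptic] [W.IsGloballyMinimal] (D : ModularParametrizationData W N)
    (h₀ : ∀ z ∈ D.L.lattice, ∃ w ∈ periodLattice D.f, z = D.c * w) {a : ℂ} (ha : a ∉ D.L.lattice) (h2a : 2 * a ∈ D.L.lattice) :
    ∃ Γ : Subgroup SL(2, ℤ),
      (∀ γ : Gamma0 N, (γ : SL(2, ℤ)) ∈ Γ ↔
        ∃ k : ℤ, ∃ ν ∈ D.L.lattice, (D.c : ℂ) * cuspSymbol D.f γ = k * (2 * a) + 2 * ν) ∧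
      Γ ≤ Gamma0 N ∧ Γ.FiniteIndex ∧ (∀ g ∈ Gamma0 N, ∀ γ ∈ Γ, g * γ * g⁻¹ ∈ Γ) ∧
      (∀ γ ∈ Gamma0 N, (γ 0 0 + γ 1 1 = 2 ∨ γ 0 0 + γ 1 1 = -2) → γ ∈ Γ) := by
  -- the subgroup
  let Γ : Subgroup SL(2, ℤ) :=
    { carrier := {g | ∃ hg : g ∈ Gamma0 N, ∃ k : ℤ, ∃ ν ∈ D.L.lattice,
        (D.c : ℂ) * cuspSymbol D.f ⟨g, hg⟩ = k * (2 * a) + 2 * ν}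
      one_mem' := by
        refine ⟨(Gamma0 N).one_mem, 0, 0, zero_mem _, ?_⟩
        have : (⟨1, (Gamma0 N).one_mem⟩ : Gamma0 N) = 1 := rfl
        rw [this, cuspSymbol_one]; simp
      mul_mem' := by
        rintro g₁ g₂ ⟨hg₁, k₁, ν₁, hν₁, e₁⟩ ⟨hg₂, k₂, ν₂, hν₂, e₂⟩
        refine ⟨(Gamma0 N).mul_mem hg₁ hg₂, k₁ + k₂, ν₁ + ν₂, add_mem hν₁ hν₂, ?_⟩
        have : (⟨g₁ * g₂, (Gamma0 N).mul_mem hg₁ hg₂⟩ : Gamma0 N) = ⟨g₁, hg₁⟩ * ⟨g₂, hg₂⟩ := rfl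
        rw [this, cuspSymbol_mul_holds, mul_add, e₁, e₂]; push_cast; ring
      inv_mem' := by
        rintro g ⟨hg, k, ν, hν, e⟩
        refine ⟨(Gamma0 N).inv_mem hg, -k, -ν, neg_mem hν, ?_⟩
        have : (⟨g⁻¹, (Gamma0 N).inv_mem hg⟩ : Gamma0 N) = ⟨g, hg⟩⁻¹ := rfl
        rw [this, cuspSymbol_inv, mul_neg, e]; push_cast; ring }
  have hmem : ∀ γ : Gamma0 N, (γ : SL(2, ℤ)) ∈ Γ ↔
      ∃ k : ℤ, ∃ ν ∈ D.L.lattice, (D.c : ℂ) * cuspSymbol D.f γ = k * (2 * a) + 2 * ν := fun γ ↦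
    ⟨fun ⟨_, h⟩ ↦ h, fun h ↦ ⟨γ.2, h⟩⟩
  refine ⟨Γ, hmem, fun g hg ↦ hg.1, ?_, ?_, ?_⟩
  · -- FINITE INDEX: two cosets over `Γ₀(N)`
    obtain ⟨r, hr, htwo⟩ := exists_two_classes_of_two_mul_mem D.L ha h2a
    obtain ⟨w, hw, hrw⟩ := h₀ r hr
    have hw' : w ∈ (periodLattice D.f : Set ℂ) := hw
    rw [coe_periodLattice_eq_range] at hw'
    obtain ⟨γ₀, rfl⟩ := hw'
    have hcoset : ∀ γ : Gamma0 N, ∃ j : ℕ, j < 2 ∧ ((γ₀ : SL(2, ℤ)) ^ j)⁻¹ * (γ : SL(2, ℤ)) ∈ Γ := by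
      intro γ
      have hx : (D.c : ℂ) * cuspSymbol D.f γ ∈ D.L.lattice := D.smul_periodLattice_le _ (cuspSymbol_mem_periodLattice D.f γ)
      obtain ⟨j, hj, k, ν, hν, e⟩ := htwo _ hx
      refine ⟨j, hj, (hmem ((γ₀ ^ j)⁻¹ * γ)).mpr ⟨k, ν, hν, ?_⟩⟩
      rw [cuspSymbol_mul_holds, cuspSymbol_inv, cuspSymbol_pow_eq_natCast_mul, ← e, hrw]; ring
    haveI : Finite (SL(2, ℤ) ⧸ Γ) := by
      refine Finite.of_surjective
        (fun p : (SL(2, ℤ) ⧸ Gamma0 N) × Fin 2 ↦ (QuotientGroup.mk (p.1.out * (γ₀ : SL(2, ℤ)) ^ (p.2 : ℕ)) : SL(2, ℤ) ⧸ Γ))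
        ?_
      intro q
      induction q using QuotientGroup.induction_on with
      | H g =>
        obtain ⟨h, hh⟩ := QuotientGroup.mk_out_eq_mul (Gamma0 N) g
        obtain ⟨j, hj, hδ⟩ := hcoset h⁻¹
        refine ⟨(QuotientGroup.mk g, ⟨j, hj⟩), ?_⟩
        show (QuotientGroup.mk ((QuotientGroup.mk g : SL(2, ℤ) ⧸ Gamma0 N).out * (γ₀ : SL(2, ℤ)) ^ j) : SL(2, ℤ) ⧸ Γ) =
          QuotientGroup.mk g
        rw [QuotientGroup.eq, hh]
        have e : ((g : SL(2, ℤ)) * (h : SL(2, ℤ)) * (γ₀ : SL(2, ℤ)) ^ j)⁻¹ * g =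
            ((γ₀ : SL(2, ℤ)) ^ j)⁻¹ * ((h⁻¹ : Gamma0 N) : SL(2, ℤ)) := by
          rw [Subgroup.coe_inv]; group
        rw [e]; exact hδ
    exact Subgroup.finiteIndex_of_finite_quotient
  · -- NORMAL in `Γ₀(N)`
    rintro g hg γ ⟨hγ, k, ν, hν, e⟩
    have hmemg : g * γ * g⁻¹ ∈ Gamma0 N := (Gamma0 N).mul_mem ((Gamma0 N).mul_mem hg hγ) ((Gamma0 N).inv_mem hg)
    refine ⟨hmemg, k, ν, hν, ?_⟩
    have : (⟨g * γ * g⁻¹, hmemg⟩ : Gamma0 N) = ⟨g, hg⟩ * ⟨γ, hγ⟩ * ⟨g, hg⟩⁻¹ := rfl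
    rw [this, cuspSymbol_mul_holds, cuspSymbol_mul_holds, cuspSymbol_inv, ← e]; ring
  · -- trace `±2` ⟹ zero discriminant ⟹ zero period
    intro γ hγ htr
    refine ⟨hγ, 0, 0, zero_mem _, ?_⟩
    have hdet : ((γ : Matrix (Fin 2) (Fin 2) ℤ)).det = 1 := γ.2
    have hdisc : ((((⟨γ, hγ⟩ : Gamma0 N) : SL(2, ℤ)) : Matrix (Fin 2) (Fin 2) ℤ)).discr = 0 := by
      show ((γ : Matrix (Fin 2) (Fin 2) ℤ)).discr = 0
      rw [Matrix.discr_fin_two, Matrix.trace_fin_two, hdet]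
      rcases htr with h | h <;> rw [h] <;> norm_num
    rw [cuspSymbol_eq_zero_of_discr_eq_zero D.f hdisc]; simp

/-- **(NC₂-a′) The period group of `V`.**  For `D` with the lattice clause and a half-period `a` (`a ∉ Λ`, `2a = m₁ω₁ + m₂ω₂`),
`Γ_V = {γ ∈ Γ₀(N) : V_{a,e}(w + c{∞,γ∞}_f) = V_{a,e}(w) ∀ w}` (`e = m₁η₁ + m₂η₂`) is a subgroup of `SL₂(ℤ)` inside `Γ₀(N)`, of finite index
(it contains `Γ_{T,2}`, §2), normal in `Γ₀(N)` (`γ ↦ c{∞,γ∞}_f` is a homomorphism to an abelian group), containing every element of trace `±2`.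
[cite: KurthLong2008, Def. 16 (shape)] [cite: Manin1972, Prop. 1.4 / Thm. 1.6] [cite: WhittakerWatson1927, §20.421] -/
theorem exists_sigmaSqRootPeriodSubgroup [W.IsElliptic] [W.IsGloballyMinimal] (D : ModularParametrizationData W N)
    (h₀ : ∀ z ∈ D.L.lattice, ∃ w ∈ periodLattice D.f, z = D.c * w) {a : ℂ} {m₁ m₂ : ℤ} (ha : a ∉ D.L.lattice)
    (h2a : 2 * a = m₁ * D.L.ω₁ + m₂ * D.L.ω₂) :
    ∃ Γ : Subgroup SL(2, ℤ),
      (∀ γ : Gamma0 N, (γ : SL(2, ℤ)) ∈ Γ ↔ ∀ w : ℂ,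
        sigmaSqRoot D.L a (m₁ * D.L.η₁ + m₂ * D.L.η₂) (w + (D.c : ℂ) * cuspSymbol D.f γ) =
          sigmaSqRoot D.L a (m₁ * D.L.η₁ + m₂ * D.L.η₂) w) ∧
      Γ ≤ Gamma0 N ∧ Γ.FiniteIndex ∧ (∀ g ∈ Gamma0 N, ∀ γ ∈ Γ, g * γ * g⁻¹ ∈ Γ) ∧
      (∀ γ ∈ Gamma0 N, (γ 0 0 + γ 1 1 = 2 ∨ γ 0 0 + γ 1 1 = -2) → γ ∈ Γ) := by
  set e : ℂ := m₁ * D.L.η₁ + m₂ * D.L.η₂ with he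
  have h2aΛ : 2 * a ∈ D.L.lattice := by rw [h2a]; exact PeriodPair.mem_lattice.mpr ⟨m₁, m₂, rfl⟩
  -- the subgroup
  let Γ : Subgroup SL(2, ℤ) :=
    { carrier := {g | ∃ hg : g ∈ Gamma0 N, ∀ w : ℂ,
        sigmaSqRoot D.L a e (w + (D.c : ℂ) * cuspSymbol D.f ⟨g, hg⟩) = sigmaSqRoot D.L a e w}
      one_mem' := by
        refine ⟨(Gamma0 N).one_mem, fun w ↦ ?_⟩
        have : (⟨1, (Gamma0 N).one_mem⟩ : Gamma0 N) = 1 := rfl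
        rw [this, cuspSymbol_one, mul_zero, add_zero]
      mul_mem' := by
        rintro g₁ g₂ ⟨hg₁, e₁⟩ ⟨hg₂, e₂⟩
        refine ⟨(Gamma0 N).mul_mem hg₁ hg₂, fun w ↦ ?_⟩
        have : (⟨g₁ * g₂, (Gamma0 N).mul_mem hg₁ hg₂⟩ : Gamma0 N) = ⟨g₁, hg₁⟩ * ⟨g₂, hg₂⟩ := rfl
        rw [this, cuspSymbol_mul_holds, mul_add, show w + ((D.c : ℂ) * cuspSymbol D.f ⟨g₁, hg₁⟩ +
          (D.c : ℂ) * cuspSymbol D.f ⟨g₂, hg₂⟩) = (w + (D.c : ℂ) * cuspSymbol D.f ⟨g₁, hg₁⟩) +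
          (D.c : ℂ) * cuspSymbol D.f ⟨g₂, hg₂⟩ by ring, e₂, e₁]
      inv_mem' := by
        rintro g ⟨hg, e₁⟩
        refine ⟨(Gamma0 N).inv_mem hg, fun w ↦ ?_⟩
        have : (⟨g⁻¹, (Gamma0 N).inv_mem hg⟩ : Gamma0 N) = ⟨g, hg⟩⁻¹ := rfl
        rw [this, cuspSymbol_inv, mul_neg]
        have h := e₁ (w + -((D.c : ℂ) * cuspSymbol D.f ⟨g, hg⟩))
        rw [show w + -((D.c : ℂ) * cuspSymbol D.f ⟨g, hg⟩) + (D.c : ℂ) * cuspSymbol D.f ⟨g, hg⟩ = w by ring] at h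
        exact h.symm }
  have hmem : ∀ γ : Gamma0 N, (γ : SL(2, ℤ)) ∈ Γ ↔ ∀ w : ℂ,
      sigmaSqRoot D.L a e (w + (D.c : ℂ) * cuspSymbol D.f γ) = sigmaSqRoot D.L a e w := fun γ ↦
    ⟨fun ⟨_, h⟩ ↦ h, fun h ↦ ⟨γ.2, h⟩⟩
  -- `Γ_{T,2} ≤ Γ_V`
  obtain ⟨Γ₂, hmem₂, hle₂, hfi₂, -, -⟩ := exists_kummerCoverSubgroupTwo D h₀ ha h2aΛ
  have hsub : Γ₂ ≤ Γ := by
    intro g hg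
    have hg0 : g ∈ Gamma0 N := hle₂ hg
    obtain ⟨k, ν, hν, hk⟩ := (hmem₂ ⟨g, hg0⟩).mp hg
    exact (hmem ⟨g, hg0⟩).mpr fun w ↦ sigmaSqRoot_periodic_of_mem_kummerTwo D.L h2a ⟨k, ν, hν, hk⟩ w
  refine ⟨Γ, hmem, fun g hg ↦ hg.1, ?_, ?_, ?_⟩
  · haveI := hfi₂; exact Subgroup.finiteIndex_of_le hsub
  · -- NORMAL in `Γ₀(N)`
    rintro g hg γ ⟨hγ, e₁⟩
    have hmemg : g * γ * g⁻¹ ∈ Gamma0 N := (Gamma0 N).mul_mem ((Gamma0 N).mul_mem hg hγ) ((Gamma0 N).inv_mem hg)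
    refine ⟨hmemg, fun w ↦ ?_⟩
    have : (⟨g * γ * g⁻¹, hmemg⟩ : Gamma0 N) = ⟨g, hg⟩ * ⟨γ, hγ⟩ * ⟨g, hg⟩⁻¹ := rfl
    rw [this, cuspSymbol_mul_holds, cuspSymbol_mul_holds, cuspSymbol_inv,
      show cuspSymbol D.f ⟨g, hg⟩ + cuspSymbol D.f ⟨γ, hγ⟩ + -cuspSymbol D.f ⟨g, hg⟩ = cuspSymbol D.f ⟨γ, hγ⟩ by ring, e₁]
  · -- trace `±2`
    intro γ hγ htr
    refine ⟨hγ, fun w ↦ ?_⟩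
    have hdet : ((γ : Matrix (Fin 2) (Fin 2) ℤ)).det = 1 := γ.2
    have hdisc : ((((⟨γ, hγ⟩ : Gamma0 N) : SL(2, ℤ)) : Matrix (Fin 2) (Fin 2) ℤ)).discr = 0 := by
      show ((γ : Matrix (Fin 2) (Fin 2) ℤ)).discr = 0
      rw [Matrix.discr_fin_two, Matrix.trace_fin_two, hdet]
      rcases htr with h | h <;> rw [h] <;> norm_num
    rw [cuspSymbol_eq_zero_of_discr_eq_zero D.f hdisc, mul_zero, add_zero]

/-! ## §4 (NC₂-glue): congruence of the ℓ = 2 Kummer character ⟹ `Γ₁(N)`-periodicity ⟹ `Λ₁(f) ≠ Λ₀(f)` -/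

/-- **Congruence ⟹ `Γ₁(N)`-periodicity.**  If `V_{a,e}` is periodic under `c{∞,γ∞}_f` for every `γ ∈ Γ₀(N) ∩ Γ(M)` (`M ≥ 1`), then for every
`γ ∈ Γ₁(N)`: `Γ_V` (§3) contains `Γ(MN) ≤ Γ₀(N) ∩ Γ(M)`, and a finite-index normal subgroup of `Γ₀(N)` with the trace-`±2` elements containing a
principal congruence subgroup contains `Γ₁(N)` (Kurth–Long Prop. 18, tree theorem `typeIINoncongruence_holds` via Wohlfahrt).
[cite: KurthLong2008, Prop. 18] -/
theorem sigmaSqRoot_gamma1_periodic_of_congruence [W.IsElliptic] [W.IsGloballyMinimal] (D : ModularParametrizationData W N)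
    (h₀ : ∀ z ∈ D.L.lattice, ∃ w ∈ periodLattice D.f, z = D.c * w) {a : ℂ} {m₁ m₂ : ℤ} (ha : a ∉ D.L.lattice)
    (h2a : 2 * a = m₁ * D.L.ω₁ + m₂ * D.L.ω₂) {M : ℕ} (hM : 0 < M)
    (hcong : ∀ γ : Gamma0 N, (γ : SL(2, ℤ)) ∈ CongruenceSubgroup.Gamma M → ∀ w : ℂ,
      sigmaSqRoot D.L a (m₁ * D.L.η₁ + m₂ * D.L.η₂) (w + (D.c : ℂ) * cuspSymbol D.f γ) =
        sigmaSqRoot D.L a (m₁ * D.L.η₁ + m₂ * D.L.η₂) w) :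
    ∀ γ : Gamma1 N, ∀ w : ℂ,
      sigmaSqRoot D.L a (m₁ * D.L.η₁ + m₂ * D.L.η₂) (w + (D.c : ℂ) * cuspSymbol D.f ⟨(γ : SL(2, ℤ)), Gamma1_in_Gamma0 N γ.2⟩) =
        sigmaSqRoot D.L a (m₁ * D.L.η₁ + m₂ * D.L.η₂) w := by
  obtain ⟨Γ, hmem, hle, hfi, hnorm, htr⟩ := exists_sigmaSqRootPeriodSubgroup D h₀ ha h2a
  have hN : 0 < N := Nat.pos_of_ne_zero (NeZero.ne N)
  -- `Γ(MN) ≤ Γ_V`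
  have hΓMN : CongruenceSubgroup.Gamma (M * N) ≤ Γ := by
    intro g hg
    have hgN : g ∈ CongruenceSubgroup.Gamma N := Gamma_mul_le_right M N hg
    have hgM : g ∈ CongruenceSubgroup.Gamma M := Gamma_mul_le_left M N hg
    have hg0 : g ∈ Gamma0 N := Gamma_le_Gamma0 N hgN
    exact (hmem ⟨g, hg0⟩).mpr (hcong ⟨g, hg0⟩ hgM)
  -- Kurth–Long, contrapositive
  have h1 : Gamma1 N ≤ Γ := by
    by_contra h
    exact typeIINoncongruence_holds N hN Γ hfi hle hnorm htr h (M * N) (Nat.mul_pos hM hN) hΓMN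
  intro γ
  exact (hmem ⟨(γ : SL(2, ℤ)), Gamma1_in_Gamma0 N γ.2⟩).mp (h1 γ.2)

/-- **Congruence ⟹ `Λ₁(f) ≠ Λ₀(f)`** (§4 ∘ LEAD's endgame `periodLatticeGamma1_ne_of_sigmaSqRoot_gamma1_periodic`): for a LATTICE-OPTIMAL datum
(`Λ_W = c·Λ₀(f)`) and a half-period `a`, if the `σ`-square root is periodic under `c{∞,γ∞}_f` for all `γ ∈ Γ₀(N) ∩ Γ(M)` then `Λ₁(f) ≠ Λ₀(f)`.
[cite: KurthLong2008, Prop. 18] [cite: Stevens1989, §2] -/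
theorem periodLatticeGamma1_ne_of_congruence [W.IsElliptic] [W.IsGloballyMinimal] (D : ModularParametrizationData W N)
    (hopt : ∀ z ∈ D.L.lattice, ∃ w ∈ periodLattice D.f, z = D.c * w) {a : ℂ} {m₁ m₂ : ℤ} (ha : a ∉ D.L.lattice)
    (h2a : 2 * a = m₁ * D.L.ω₁ + m₂ * D.L.ω₂) {M : ℕ} (hM : 0 < M)
    (hcong : ∀ γ : Gamma0 N, (γ : SL(2, ℤ)) ∈ CongruenceSubgroup.Gamma M → ∀ w : ℂ,
      sigmaSqRoot D.L a (m₁ * D.L.η₁ + m₂ * D.L.η₂) (w + (D.c : ℂ) * cuspSymbol D.f γ) =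
        sigmaSqRoot D.L a (m₁ * D.L.η₁ + m₂ * D.L.η₂) w) :
    periodLatticeGamma1 D.f ≠ periodLattice D.f :=
  periodLatticeGamma1_ne_of_sigmaSqRoot_gamma1_periodic D hopt ha h2a
    (sigmaSqRoot_gamma1_periodic_of_congruence D hopt ha h2a hM hcong)

/-- **Congruence ⟹ `{∞,0}_f ∉ Λ₀(f)` (analytic rank `0`)**, modulo F★, F♮, CES (LEAD's `modularSymbol_zero_not_mem_of_ne_of_print`).
CONDITIONAL on the three printed cusp facts. [cite: Stevens1989, §2] [cite: ConradEdixhovenStein2003, §6.1.2, Thm. 1.1.3] [cite: Stevens1982, Thm. 1.3.1] -/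
theorem modularSymbol_zero_not_mem_of_congruence_of_print [W.IsElliptic] [W.IsGloballyMinimal]
    (hF : optimalGamma1Parametrization_cusp_rational) (hFnat : optimalGamma1Parametrization_cuspZero_galoisConjugate)
    (hCES : exists_optimal_gamma1ParametrizationData) (D : ModularParametrizationData W N)
    (hopt : ∀ z ∈ D.L.lattice, ∃ w ∈ periodLattice D.f, z = D.c * w) {a : ℂ} {m₁ m₂ : ℤ} (ha : a ∉ D.L.lattice)
    (h2a : 2 * a = m₁ * D.L.ω₁ + m₂ * D.L.ω₂) {M : ℕ} (hM : 0 < M)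
    (hcong : ∀ γ : Gamma0 N, (γ : SL(2, ℤ)) ∈ CongruenceSubgroup.Gamma M → ∀ w : ℂ,
      sigmaSqRoot D.L a (m₁ * D.L.η₁ + m₂ * D.L.η₂) (w + (D.c : ℂ) * cuspSymbol D.f γ) =
        sigmaSqRoot D.L a (m₁ * D.L.η₁ + m₂ * D.L.η₂) w) :
    modularSymbol D.f 0 ∉ periodLattice D.f :=
  modularSymbol_zero_not_mem_of_ne_of_print hF hFnat hCES D hopt (periodLatticeGamma1_ne_of_congruence D hopt ha h2a hM hcong)

/-- **Congruence ⟹ ROOT NUMBER `+1`** (conductor level), modulo F★, F♮, CES: on the root-number-`−1` half the congruence conclusion of an ℓ = 2 UDC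
chain is IMPOSSIBLE (LEAD's `periodLatticeGamma1_eq_of_rootNumber_eq_neg_one_of_print`).  CONDITIONAL on the three printed cusp facts.
[cite: Stevens1989, §2] [cite: AtkinLehner1970, Thm. 3] [cite: ConradEdixhovenStein2003, §6.1.2, Thm. 1.1.3] [cite: Stevens1982, Thm. 1.3.1] -/
theorem rootNumber_eq_one_of_congruence_of_print [W.IsElliptic] [W.IsGloballyMinimal] [NeZero (W.conductorNorm ℤ)]
    (hF : optimalGamma1Parametrization_cusp_rational) (hFnat : optimalGamma1Parametrization_cuspZero_galoisConjugate)
    (hCES : exists_optimal_gamma1ParametrizationData) (D : ModularParametrizationData W (W.conductorNorm ℤ))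
    (hopt : ∀ z ∈ D.L.lattice, ∃ w ∈ periodLattice D.f, z = D.c * w) {a : ℂ} {m₁ m₂ : ℤ} (ha : a ∉ D.L.lattice)
    (h2a : 2 * a = m₁ * D.L.ω₁ + m₂ * D.L.ω₂) {M : ℕ} (hM : 0 < M)
    (hcong : ∀ γ : Gamma0 (W.conductorNorm ℤ), (γ : SL(2, ℤ)) ∈ CongruenceSubgroup.Gamma M → ∀ w : ℂ,
      sigmaSqRoot D.L a (m₁ * D.L.η₁ + m₂ * D.L.η₂) (w + (D.c : ℂ) * cuspSymbol D.f γ) =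
        sigmaSqRoot D.L a (m₁ * D.L.η₁ + m₂ * D.L.η₂) w) :
    W.rootNumber = 1 := by
  rcases W.rootNumber_eq_one_or with h | h
  · exact h
  · exact absurd (periodLatticeGamma1_eq_of_rootNumber_eq_neg_one_of_print hF hFnat hCES D hopt h)
      (periodLatticeGamma1_ne_of_congruence D hopt ha h2a hM hcong)

end Summit.BirchSwinnertonDyer.BirchSwinnertonDyer.Theorems.ManinLocalTwoThree.UDCTwo

end
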